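import Summits.NavierStokesRegularity.FluidComputer.LevelTransferFloor
import Summits.NavierStokesRegularity.FluidComputer.BlockEnergyContinuity
import HarnessLib

/-!
# Fluid computer — L14: the transfer ceiling in AMPLITUDE form (linear in the block's own amplitude)

HONEST FRAMING (cell `pub-fluidc`, verbatim): *low prior, high value-of-information experiment on Tao's
machine paradigm; NOT a claim that NS blows up.* Theorem side of the cell (ceilings / necessities every cascade
design must respect); nothing here is evidence of blow-up, and nothing is said about any fixed finite set of levels.

The transfer ceiling L12″ (`LevelTransferFloor.blockL2_sq_le_add_local`) bounds the ENERGY handed into a level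
between two times of a maximal smooth finite-energy solution:
`‖Δ̇_j u(t)‖₂² ≤ ‖Δ̇_j u(s)‖₂² + 2 ∫⁻_{(s,t]} A·( a_j X_j + s_j Q_j ) dτ`, `a_l = ‖Δ̇_l u‖₂`, `s_l = ‖Δ̇_l u‖_∞`,
`X_j = ∑_{|m| ≤ 2} a_{j+m} T_{j+m}` (neighbour amplitudes × the Lipschitz size `T_l = ∑_{l' ≤ l-3} 2^{l'} s_{l'}` of the
coarser levels), `Q_j` the weighted energy pairs of comparable-or-finer levels. EVERY term of the integrand carries the
block's own amplitude (`a_j` or `s_j ≤ C_B 2^{3j/2} a_j`, Bernstein). Since the block energies are continuous in time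
(`BlockEnergyContinuity.continuousOn_blockL2_sq`), the square root can be taken INSIDE the time integral — a Bihari /
square-root step, proved here as a solution-free real-variable lemma — and the ceiling becomes LINEAR in the block's
own amplitude:

* `sqrt_step` (pure analysis) — if `a : ℝ → [0, ∞]` is continuous and finite on `[s, t]` and
  `a(τ)² ≤ a(σ)² + 2 ∫⁻_{(σ,τ]} a·G` for all `s ≤ σ ≤ τ ≤ t`, then `a(t) ≤ a(s) + ∫⁻_{(s,t]} G` (no measurability of `G`
  is needed: a real-induction argument on the first bad time, with a positive floor under `a` removed at the end).
* `exists_blockSup_le_blockL2` — Bernstein on the blocks of an `L²` field on `ℝ³`: `‖Δ̇_j v‖_∞ ≤ C_B 2^{3j/2} ‖Δ̇_j v‖₂`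
  (the tree's distribution-level `exists_eLpNormDistrib_lpBlock_le 2 ∞` read through `IsDistributionOf`).
* `blockL2_le_add_of_forall_le` (**L14, master form**) — for every maximal smooth solution `(u, p)` on `ℝ³ × [0,T)`
  (`ν > 0`), Leray–Hopf from `u 0`, all `0 < s ≤ t < T`, every level `j` and every `G : ℝ → [0,∞]` dominating the local
  feeding RATE per unit of own amplitude on the window, `A (a_j X_j + s_j Q_j)(τ) ≤ a_j(τ) G(τ)` for `τ ∈ (s, t]`:
  `a_j(t) ≤ a_j(s) + ∫⁻_{(s,t]} G`.
* `blockL2_le_add_local` (**L14 — THE AMPLITUDE CEILING**) — unconditionally, with the Bernstein constant: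
  `‖Δ̇_j u(t)‖₂ ≤ ‖Δ̇_j u(s)‖₂ + ∫⁻_{(s,t]} A·( X_j + C_B 2^{3j/2} Q_j ) dτ`. Cascade reading: the AMPLITUDE handed into
  a level during a window is at most `A ×` the time integral of [neighbour amplitudes × coarse strain] plus the
  fine-pair term — a bound that no longer contains the receiving level's state except through the `m = 0` strain term
  `a_j T_j`; in particular (next file, `LevelStrainClock`) a level e-folds no faster than `A T_j`, the Lipschitz size of
  the levels beneath it. Ceiling only; nothing about sufficiency.

0 sorry; no new definitions, no named facts (inputs: `LevelTransferFloor.blockL2_sq_le_add_local`,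
`BlockEnergyContinuity.continuousOn_blockL2_sq`, `exists_eLpNormDistrib_lpBlock_le`, `isDistributionOf_toTemperedDistribution`).

## References

* A. Cheskidov, M. Dai, *Regularity criteria for the 3D Navier–Stokes and MHD equations*, arXiv:1507.06611 =
  Proc. Edinburgh Math. Soc. (2025), §3.1, (3.6). [CheskidovDai2015]
* H. Bahouri, J.-Y. Chemin, R. Danchin, *Fourier Analysis and Nonlinear PDE*, Springer 2011, Lemma 2.1 (Bernstein);
  §3.2 (growth of dyadic blocks at the Lipschitz rate of the advecting field — context). [BahouriCheminDanchin2011]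
-/

noncomputable section

open MeasureTheory Set Function Filter Topology TemperedDistribution
open scoped ENNReal NNReal SchwartzMap
open Literature.Analysis.FluidPDE Literature.Analysis.FunctionSpaces

namespace Summit.NavierStokesRegularity.FluidComputer.BlockAmplitudeCeiling

/-! ## The square-root step (solution-free real analysis) -/

/-- Algebra of the local step: `x² ≤ y² + 2 (y + θ δ) Φ` with `0 < δ ≤ y < ∞` forces `x ≤ y + (1 + θ) Φ`
(square the right-hand side and compare). [folklore] -/
theorem le_add_of_sq_le_sq_add {x y δ θ Φ : ℝ≥0∞} (hδy : δ ≤ y) (hy : y ≠ ∞)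
    (h : x ^ 2 ≤ y ^ 2 + 2 * (y + θ * δ) * Φ) : x ≤ y + (1 + θ) * Φ := by
  rw [← ENNReal.pow_le_pow_left_iff two_ne_zero]
  refine h.trans ?_
  have hδtop : δ ≠ ∞ := ne_top_of_le_ne_top hy hδy
  have hθδ : θ * δ ≤ θ * y := mul_le_mul' le_rfl hδy
  calc y ^ 2 + 2 * (y + θ * δ) * Φ ≤ y ^ 2 + 2 * (y + θ * y) * Φ := by gcongr
    _ = y ^ 2 + 2 * (y * ((1 + θ) * Φ)) := by ring
    _ ≤ y ^ 2 + 2 * (y * ((1 + θ) * Φ)) + ((1 + θ) * Φ) ^ 2 := le_self_add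
    _ = (y + (1 + θ) * Φ) ^ 2 := by ring

/-- Real induction with a monotone majorant: if `f ≤ g` at `s`, `f` is continuous on `[s, t]`, `g` is monotone, and
from every good time `τ < t` (`f τ ≤ g τ`) goodness propagates to a right-neighbourhood, then `f ≤ g` on `[s, t]`
(first bad time argument; no closedness of the good set is needed because `g` is monotone and `f` continuous).
[folklore] -/
theorem Icc_induction_of_monotone {f g : ℝ → ℝ≥0∞} {s t : ℝ}
    (hf : ContinuousOn f (Icc s t)) (hg : MonotoneOn g (Icc s t)) (h0 : f s ≤ g s)
    (hstep : ∀ τ ∈ Ico s t, f τ ≤ g τ → ∃ η > 0, ∀ τ' ∈ Ioo τ (τ + η), τ' ≤ t → f τ' ≤ g τ') :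
    ∀ τ ∈ Icc s t, f τ ≤ g τ := by
  by_contra hbad
  simp only [not_forall, not_le, exists_prop] at hbad
  set B : Set ℝ := {τ | τ ∈ Icc s t ∧ g τ < f τ} with hB
  have hBne : B.Nonempty := by
    obtain ⟨τ, hτ, hlt⟩ := hbad
    exact ⟨τ, hτ, hlt⟩
  have hBbdd : BddBelow B := ⟨s, fun τ hτ => hτ.1.1⟩
  set τ₀ := sInf B with hτ₀
  have hτ₀s : s ≤ τ₀ := le_csInf hBne fun τ hτ => hτ.1.1
  have hτ₀t : τ₀ ≤ t := by
    obtain ⟨τ, hτ⟩ := hBne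
    exact (csInf_le hBbdd hτ).trans hτ.1.2
  have hτ₀I : τ₀ ∈ Icc s t := ⟨hτ₀s, hτ₀t⟩
  -- every time before `τ₀` is good
  have hgood : ∀ σ ∈ Ico s τ₀, f σ ≤ g σ := by
    intro σ hσ
    by_contra hc
    have hσB : σ ∈ B := ⟨⟨hσ.1, hσ.2.le.trans hτ₀t⟩, not_le.mp hc⟩
    exact absurd (csInf_le hBbdd hσB) (not_le.mpr hσ.2)
  -- `τ₀` itself is good (continuity from the left + monotonicity of `g`)
  have hτ₀good : f τ₀ ≤ g τ₀ := by
    rcases eq_or_lt_of_le hτ₀s with h | h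
    · rw [← h]; exact h0
    · -- limit from the left inside `[s, t]`
      have hcw : ContinuousWithinAt f (Ico s τ₀) τ₀ :=
        (hf τ₀ hτ₀I).mono fun σ hσ => ⟨hσ.1, hσ.2.le.trans hτ₀t⟩
      haveI : (𝓝[Ico s τ₀] τ₀).NeBot := by
        rw [← mem_closure_iff_nhdsWithin_neBot, closure_Ico h.ne]
        exact ⟨h.le, le_rfl⟩
      refine le_of_tendsto hcw ?_
      filter_upwards [self_mem_nhdsWithin] with σ hσ
      exact (hgood σ hσ).trans (hg ⟨hσ.1, hσ.2.le.trans hτ₀t⟩ hτ₀I hσ.2.le)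
  -- `τ₀ < t`: otherwise `B ⊆ {t}` and `t` would be bad
  have hτ₀lt : τ₀ < t := by
    rcases eq_or_lt_of_le hτ₀t with h | h
    · exfalso
      obtain ⟨τ, hτ⟩ := hBne
      have hτeq : τ = τ₀ := le_antisymm (h ▸ hτ.1.2) (csInf_le hBbdd hτ)
      exact absurd hτ₀good (not_le.mpr (hτeq ▸ hτ.2))
    · exact h
  obtain ⟨η, hη, hprop⟩ := hstep τ₀ ⟨hτ₀s, hτ₀lt⟩ hτ₀good
  -- every element of `B` is at least `τ₀ + η`: contradiction with `τ₀ = inf B`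
  have hlb : ∀ τ ∈ B, τ₀ + min η (t - τ₀) ≤ τ := by
    intro τ hτ
    by_contra hc
    rw [not_le] at hc
    have hτ₀τ : τ₀ ≤ τ := csInf_le hBbdd hτ
    rcases eq_or_lt_of_le hτ₀τ with h | h
    · exact absurd hτ₀good (not_le.mpr (h ▸ hτ.2))
    · have hτ' : τ ∈ Ioo τ₀ (τ₀ + η) := ⟨h, hc.trans_le (by gcongr; exact min_le_left _ _)⟩
      exact absurd (hprop τ hτ' hτ.1.2) (not_le.mpr hτ.2)
  have : τ₀ + min η (t - τ₀) ≤ τ₀ := le_csInf hBne hlb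
  have hmin : 0 < min η (t - τ₀) := lt_min hη (sub_pos.mpr hτ₀lt)
  linarith

/-- Continuity bookkeeping: a continuous finite `[0,∞]`-valued function is, near each point of `[s,t]`, within `ε` of
its value from above. [folklore] -/
theorem exists_forall_le_add_of_continuousOn {f : ℝ → ℝ≥0∞} {s t : ℝ} (hf : ContinuousOn f (Icc s t))
    {τ : ℝ} (hτ : τ ∈ Icc s t) (hfin : f τ ≠ ∞) {ε : ℝ≥0∞} (hε : 0 < ε) :
    ∃ η > 0, ∀ r ∈ Icc s t, dist r τ < η → f r ≤ f τ + ε := by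
  have h := (ENNReal.tendsto_nhds hfin).1 (hf τ hτ) ε hε
  rw [(Metric.nhdsWithin_basis_ball).eventually_iff] at h
  obtain ⟨η, hη, hball⟩ := h
  exact ⟨η, hη, fun r hr hd => (hball ⟨hd, hr⟩).2⟩

/-- **The square-root (Bihari) step, with a positive floor.** If `f : ℝ → [0,∞]` is continuous and finite on
`[s,t]`, bounded below by `δ > 0`, and `f(τ)² ≤ f(σ)² + 2 ∫⁻_{(σ,τ]} f·G` for all `s ≤ σ ≤ τ ≤ t`, then for every
`θ > 0`, `f(t) ≤ f(s) + (1 + θ) ∫⁻_{(s,t]} G`. [folklore] -/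
theorem sqrt_step_floor {f G : ℝ → ℝ≥0∞} {s t : ℝ} (hst : s ≤ t)
    (hf : ContinuousOn f (Icc s t)) (hfin : ∀ τ ∈ Icc s t, f τ ≠ ∞)
    {δ : ℝ≥0∞} (hδ : δ ≠ 0) (hδf : ∀ τ ∈ Icc s t, δ ≤ f τ)
    (h : ∀ σ τ, s ≤ σ → σ ≤ τ → τ ≤ t → f τ ^ 2 ≤ f σ ^ 2 + 2 * ∫⁻ r in Ioc σ τ, f r * G r)
    {θ : ℝ≥0∞} (hθ : 0 < θ) (hθtop : θ ≠ ∞) :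
    f t ≤ f s + (1 + θ) * ∫⁻ r in Ioc s t, G r := by
  have hδtop : δ ≠ ∞ := ne_top_of_le_ne_top (hfin s (left_mem_Icc.2 hst)) (hδf s (left_mem_Icc.2 hst))
  -- the majorant `g τ = f s + (1 + θ) Φ(s, τ)` is monotone
  set g : ℝ → ℝ≥0∞ := fun τ => f s + (1 + θ) * ∫⁻ r in Ioc s τ, G r with hg
  have hgmono : MonotoneOn g (Icc s t) := fun τ₁ _ τ₂ _ h12 =>
    add_le_add le_rfl (mul_le_mul' le_rfl (lintegral_mono_set (Ioc_subset_Ioc_right h12)))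
  have h0 : f s ≤ g s := by simp [hg]
  refine Icc_induction_of_monotone hf hgmono h0 ?_ t (right_mem_Icc.2 hst)
  intro τ hτ hgoodτ
  -- continuity: `f ≤ f τ + θ δ` on a right-neighbourhood of `τ`
  have hθδ : 0 < θ * δ := ENNReal.mul_pos hθ.ne' hδ
  obtain ⟨η, hη, hnear⟩ :=
    exists_forall_le_add_of_continuousOn hf (Ico_subset_Icc_self hτ) (hfin τ (Ico_subset_Icc_self hτ)) hθδ
  refine ⟨η, hη, fun τ' hτ' hτ't => ?_⟩
  have hττ' : τ ≤ τ' := hτ'.1.le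
  -- the local energy step, with the integrand bounded through continuity
  have hloc : f τ' ^ 2 ≤ f τ ^ 2 + 2 * (f τ + θ * δ) * ∫⁻ r in Ioc τ τ', G r := by
    refine (h τ τ' hτ.1 hττ' hτ't).trans ?_
    have hmono : ∫⁻ r in Ioc τ τ', f r * G r ≤ ∫⁻ r in Ioc τ τ', (f τ + θ * δ) * G r := by
      refine setLIntegral_mono' measurableSet_Ioc fun r hr => mul_le_mul' ?_ le_rfl
      refine hnear r ⟨hτ.1.trans hr.1.le, hr.2.trans hτ't⟩ ?_
      rw [Real.dist_eq, abs_of_pos (sub_pos.2 hr.1)]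
      linarith [hτ'.2, hr.2]
    have hc : f τ + θ * δ ≠ ∞ :=
      ENNReal.add_ne_top.2 ⟨hfin τ (Ico_subset_Icc_self hτ), ENNReal.mul_ne_top hθtop hδtop⟩
    rw [lintegral_const_mul' _ _ hc] at hmono
    calc f τ ^ 2 + 2 * ∫⁻ r in Ioc τ τ', f r * G r
        ≤ f τ ^ 2 + 2 * ((f τ + θ * δ) * ∫⁻ r in Ioc τ τ', G r) := by gcongr
      _ = f τ ^ 2 + 2 * (f τ + θ * δ) * ∫⁻ r in Ioc τ τ', G r := by ring
  have hstep := le_add_of_sq_le_sq_add (hδf τ (Ico_subset_Icc_self hτ))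
    (hfin τ (Ico_subset_Icc_self hτ)) hloc
  -- chain with the induction hypothesis and the additivity of the time integral
  have hunion : (∫⁻ r in Ioc s τ, G r) + ∫⁻ r in Ioc τ τ', G r = ∫⁻ r in Ioc s τ', G r := by
    rw [← lintegral_union measurableSet_Ioc (Ioc_disjoint_Ioc_of_le le_rfl), Ioc_union_Ioc_eq_Ioc hτ.1 hττ']
  calc f τ' ≤ f τ + (1 + θ) * ∫⁻ r in Ioc τ τ', G r := hstep
    _ ≤ g τ + (1 + θ) * ∫⁻ r in Ioc τ τ', G r := by gcongr
    _ = f s + (1 + θ) * ((∫⁻ r in Ioc s τ, G r) + ∫⁻ r in Ioc τ τ', G r) := by simp only [hg]; ring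
    _ = g τ' := by simp only [hg, hunion]

/-- **The square-root (Bihari) step.** If `a : ℝ → [0,∞]` is continuous and finite on `[s,t]` and
`a(τ)² ≤ a(σ)² + 2 ∫⁻_{(σ,τ]} a·G` for all `s ≤ σ ≤ τ ≤ t` (an energy balance whose feeding term carries the amplitude
`a` as a factor), then `a(t) ≤ a(s) + ∫⁻_{(s,t]} G`: the square root passes inside the time integral. No measurability
of `G` is assumed. Proof: `sqrt_step_floor` for `max a δ`, then `δ → 0`, `θ → 0`. [folklore] -/
theorem sqrt_step {a G : ℝ → ℝ≥0∞} {s t : ℝ} (hst : s ≤ t)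
    (ha : ContinuousOn a (Icc s t)) (hfin : ∀ τ ∈ Icc s t, a τ ≠ ∞)
    (h : ∀ σ τ, s ≤ σ → σ ≤ τ → τ ≤ t → a τ ^ 2 ≤ a σ ^ 2 + 2 * ∫⁻ r in Ioc σ τ, a r * G r) :
    a t ≤ a s + ∫⁻ r in Ioc s t, G r := by
  set Φ := ∫⁻ r in Ioc s t, G r with hΦ
  -- with a floor `δ` and a slack `θ`
  have hfloor : ∀ δ : ℝ≥0∞, δ ≠ 0 → δ ≠ ∞ → ∀ θ : ℝ≥0∞, 0 < θ → θ ≠ ∞ →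
      a t ≤ a s + δ + (1 + θ) * Φ := by
    intro δ hδ hδtop θ hθ hθtop
    set f : ℝ → ℝ≥0∞ := fun τ => a τ ⊔ δ with hf
    have hfc : ContinuousOn f (Icc s t) := ha.sup continuousOn_const
    have hδf : ∀ τ ∈ Icc s t, δ ≤ f τ := fun τ _ => le_sup_right
    have haf : ∀ τ, a τ ≤ f τ := fun τ => le_sup_left
    have hffin : ∀ τ ∈ Icc s t, f τ ≠ ∞ := fun τ hτ =>
      ne_top_of_le_ne_top (ENNReal.add_ne_top.2 ⟨hfin τ hτ, hδtop⟩) (sup_le le_self_add le_add_self)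
    have hf2 : ∀ σ τ, s ≤ σ → σ ≤ τ → τ ≤ t → f τ ^ 2 ≤ f σ ^ 2 + 2 * ∫⁻ r in Ioc σ τ, f r * G r := by
      intro σ τ hσ hστ hτt
      have hrhs : a σ ^ 2 + 2 * ∫⁻ r in Ioc σ τ, a r * G r ≤ f σ ^ 2 + 2 * ∫⁻ r in Ioc σ τ, f r * G r :=
        add_le_add (ENNReal.pow_le_pow_left (haf σ))
          (mul_le_mul' le_rfl (lintegral_mono fun r => mul_le_mul' (haf r) le_rfl))
      rcases le_total (a τ) δ with hle | hle
      · have hfτ : f τ = δ := sup_eq_right.2 hle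
        rw [hfτ]
        calc δ ^ 2 ≤ f σ ^ 2 := ENNReal.pow_le_pow_left (hδf σ ⟨hσ, hστ.trans hτt⟩)
          _ ≤ f σ ^ 2 + 2 * ∫⁻ r in Ioc σ τ, f r * G r := le_self_add
      · have hfτ : f τ = a τ := sup_eq_left.2 hle
        rw [hfτ]
        exact (h σ τ hσ hστ hτt).trans hrhs
    have key := sqrt_step_floor hst hfc hffin hδ hδf hf2 hθ hθtop
    calc a t ≤ f t := haf t
      _ ≤ f s + (1 + θ) * Φ := key
      _ ≤ a s + δ + (1 + θ) * Φ := by gcongr; exact sup_le le_self_add le_add_self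
  -- remove the slack and the floor
  refine ENNReal.le_of_forall_pos_le_add fun ε hε hlt => ?_
  have hΦtop : Φ ≠ ∞ := (lt_of_le_of_lt le_add_self hlt).ne
  have hε2 : (ε : ℝ≥0∞) / 2 ≠ 0 := by simp [hε.ne']
  have hε2top : (ε : ℝ≥0∞) / 2 ≠ ∞ := ENNReal.div_ne_top ENNReal.coe_ne_top two_ne_zero
  -- slack `θ = (ε/2)/(Φ+1)` so that `θ Φ ≤ ε/2`
  set θ : ℝ≥0∞ := (ε : ℝ≥0∞) / 2 / (Φ + 1) with hθ
  have hΦ1 : Φ + 1 ≠ 0 := by simp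
  have hΦ1top : Φ + 1 ≠ ∞ := ENNReal.add_ne_top.2 ⟨hΦtop, ENNReal.one_ne_top⟩
  have hθpos : 0 < θ := ENNReal.div_pos hε2 hΦ1top
  have hθtop : θ ≠ ∞ := ENNReal.div_ne_top hε2top hΦ1
  have hθΦ : θ * Φ ≤ (ε : ℝ≥0∞) / 2 :=
    calc θ * Φ ≤ θ * (Φ + 1) := mul_le_mul' le_rfl le_self_add
      _ = (ε : ℝ≥0∞) / 2 := ENNReal.div_mul_cancel hΦ1 hΦ1top
  calc a t ≤ a s + (ε : ℝ≥0∞) / 2 + (1 + θ) * Φ := hfloor _ hε2 hε2top θ hθpos hθtop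
    _ = a s + Φ + ((ε : ℝ≥0∞) / 2 + θ * Φ) := by ring
    _ ≤ a s + Φ + ((ε : ℝ≥0∞) / 2 + (ε : ℝ≥0∞) / 2) := by gcongr
    _ = a s + Φ + ε := by rw [ENNReal.add_halves]

/-! ## Bernstein on the blocks of an `L²` field -/

/-- **Bernstein, function level.** There is an absolute constant `C_B ≠ 0` such that for every `v ∈ L²(ℝ³; ℝ³)` and every
level `j ∈ ℤ`: `‖Δ̇_j v‖_∞ ≤ C_B 2^{3j/2} ‖Δ̇_j v‖₂` — the tree's distribution-level Bernstein inequality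
`exists_eLpNormDistrib_lpBlock_le 2 ∞` (BCD Lemma 2.1) read through the distribution of `v`
(`isDistributionOf_toTemperedDistribution`, `IsDistributionOf.eLpNormDistrib_lpBlock_eq_self` / `_top_lpBlock_eq`).
In cascade words: the COHERENCE of a band, `s_j / (2^{3j/2} a_j)`, is at most `C_B`.
[cite: BahouriCheminDanchin2011, Lemma 2.1] -/
theorem exists_blockSup_le_blockL2 :
    ∃ C : ℝ≥0, C ≠ 0 ∧ ∀ (v : EuclideanSpace ℝ (Fin 3) → EuclideanSpace ℝ (Fin 3)), MemLp v 2 volume →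
      ∀ j : ℤ, blockSup v j ≤ C * (2 : ℝ≥0∞) ^ (3 * (j : ℝ) / 2) * blockL2 v j := by
  obtain ⟨C, hC0, hB⟩ := exists_eLpNormDistrib_lpBlock_le
    (E := EuclideanSpace ℝ (Fin 3)) (F := EuclideanSpace ℂ (Fin 3)) 2 ∞ le_top
  refine ⟨C, hC0, fun v hv j => ?_⟩
  have hV := isDistributionOf_toTemperedDistribution hv
  set V := Lp.toTemperedDistribution ((memLp_complexify_comp hv).toLp _) with hVdef
  have hexp : ((j : ℤ) : ℝ) * Module.finrank ℝ (EuclideanSpace ℝ (Fin 3)) *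
      ((2 : ℝ≥0∞).toReal⁻¹ - (∞ : ℝ≥0∞).toReal⁻¹) = 3 * (j : ℝ) / 2 := by
    simp; ring
  have hb := hB j V
  rw [hexp, hV.eLpNormDistrib_top_lpBlock_eq hv j, hV.eLpNormDistrib_lpBlock_eq_self hv j] at hb
  exact hb

/-! ## L14 — the amplitude form of the transfer ceiling -/

/-- Time-continuity and finiteness of the block AMPLITUDES `τ ↦ ‖Δ̇_j u(τ)‖₂` of a maximal smooth solution which is
Leray–Hopf from `u 0`, on every `[s, t] ⊂ (0, T)` (square root of `BlockEnergyContinuity.continuousOn_blockL2_sq`;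
finiteness from `‖Δ̇_j f‖₂ ≤ C₂ ‖f‖₂` and the energy class). [cite: CheskidovShvydkoy2010, Lemma 3.2 (proof, (8))] -/
theorem continuousOn_blockL2 {ν T : ℝ} (hν : 0 < ν) (hT : 0 < T)
    {u : ℝ → EuclideanSpace ℝ (Fin 3) → EuclideanSpace ℝ (Fin 3)} {p : ℝ → EuclideanSpace ℝ (Fin 3) → ℝ}
    (hmax : IsMaximalSmoothSolution ν 0 u p T) (hLH : IsLerayHopfOn T ν 0 (u 0) u) (j : ℤ)
    {s t : ℝ} (hs : 0 < s) (htT : t < T) :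
    ContinuousOn (fun τ => blockL2 (u τ) j) (Icc s t) ∧ ∀ τ ∈ Icc s t, blockL2 (u τ) j ≠ ∞ := by
  have hsub : Icc s t ⊆ Ioo 0 T := fun τ hτ => ⟨hs.trans_le hτ.1, hτ.2.trans_lt htT⟩
  refine ⟨?_, fun τ hτ => ?_⟩
  · have h2 := (BlockEnergyContinuity.continuousOn_blockL2_sq hν hT hmax hLH j).mono hsub
    have hcomp : ContinuousOn (fun τ => (blockL2 (u τ) j ^ 2) ^ ((2 : ℕ)⁻¹ : ℝ)) (Icc s t) :=
      ENNReal.continuous_rpow_const.comp_continuousOn h2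
    refine hcomp.congr fun τ _ => ?_
    simp only [ENNReal.pow_rpow_inv_natCast two_ne_zero]
  · have hτT : τ ∈ Icc 0 T := ⟨(hsub hτ).1.le, (hsub hτ).2.le⟩
    have hle := (lpBounds (Fin 3)).two_le j (u τ) (hLH.memLp τ hτT)
    exact ne_top_of_le_ne_top (ENNReal.mul_ne_top ENNReal.coe_ne_top (hLH.memLp τ hτT).eLpNorm_ne_top) hle

/-- **L14, MASTER FORM — the transfer ceiling is linear in the block's own amplitude.** There is an absolute FINITE
constant `A` (the Littlewood–Paley constant of `LevelTransferFloor.blockL2_sq_le_add_local`) such that for every `ν > 0`,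
`T > 0`, every maximal smooth solution `(u, p)` of the unforced Navier–Stokes system on `ℝ³ × [0, T)` which is
Leray–Hopf from `u 0`, all times `0 < s ≤ t < T`, every level `j ∈ ℤ`, and every `G : ℝ → [0, ∞]` that dominates the
local feeding rate PER UNIT OF OWN AMPLITUDE on the window —
`A · ( a_j(τ) X_j(τ) + s_j(τ) Q_j(τ) ) ≤ a_j(τ) · G(τ)` for `τ ∈ (s, t]`, with `a_l = ‖Δ̇_l u(τ)‖₂`, `s_l = ‖Δ̇_l u(τ)‖_∞`,
`X_j = ∑_{|m|≤2} a_{j+m} T_{j+m}`, `T_l = ∑_{l'≤l-3} 2^{l'} s_{l'}`, `Q_j = ∑_{l ≥ j-4, |m| ≤ 2} a_l 2^{l+m} a_{l+m}` —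
one has `‖Δ̇_j u(t)‖₂ ≤ ‖Δ̇_j u(s)‖₂ + ∫⁻_{(s,t]} G`. Proof: the energy ceiling L12″ on every sub-window of `[s, t]`,
the domination, and the square-root step `sqrt_step` (legitimate by the time-continuity of the block amplitudes,
`continuousOn_blockL2`). Typical dominators: `G = A (X_j + C_B 2^{3j/2} Q_j)` (Bernstein, `blockL2_le_add_local`), or
`G = A (X_j + φ 2^{3j/2} Q_j)` on a window where the band's coherence `s_j/(2^{3j/2} a_j)` is observed to be at most
`φ`. Ceiling only; nothing about sufficiency. [cite: CheskidovDai2015, §3.1 (3.6)] -/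
theorem blockL2_le_add_of_forall_le :
    ∃ A : ℝ≥0∞, A ≠ ∞ ∧ ∀ (ν T : ℝ), 0 < ν → 0 < T →
      ∀ (u : ℝ → EuclideanSpace ℝ (Fin 3) → EuclideanSpace ℝ (Fin 3)) (p : ℝ → EuclideanSpace ℝ (Fin 3) → ℝ),
      IsMaximalSmoothSolution ν 0 u p T → IsLerayHopfOn T ν 0 (u 0) u →
      ∀ s t : ℝ, 0 < s → s ≤ t → t < T → ∀ (j : ℤ) (G : ℝ → ℝ≥0∞),
        (∀ τ ∈ Ioc s t, A *
            (blockL2 (u τ) j * ∑ m ∈ Finset.Icc (-2 : ℤ) 2, blockL2 (u τ) (j + m) *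
                paraT (fun l => (2 : ℝ≥0∞) ^ l * blockSup (u τ) l) (j + m) +
              blockSup (u τ) j * paraQ2 (blockL2 (u τ)) (fun l => (2 : ℝ≥0∞) ^ l * blockL2 (u τ) l) j) ≤
          blockL2 (u τ) j * G τ) →
        blockL2 (u t) j ≤ blockL2 (u s) j + ∫⁻ τ in Ioc s t, G τ := by
  obtain ⟨A, hA, H⟩ := LevelTransferFloor.blockL2_sq_le_add_local
  refine ⟨A, hA, fun ν T hν hT u p hmax hLH s t hs hst htT j G hdom => ?_⟩
  obtain ⟨hcont, hfin⟩ := continuousOn_blockL2 hν hT hmax hLH j hs htT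
  refine sqrt_step hst hcont hfin fun σ τ hsσ hστ hτt => ?_
  refine (H ν T hν hT u p hmax hLH σ τ (hs.trans_le hsσ) hστ (hτt.trans_lt htT) j).trans ?_
  gcongr blockL2 (u σ) j ^ 2 + 2 * ?_
  exact setLIntegral_mono' measurableSet_Ioc fun r hr => hdom r ⟨hsσ.trans_lt hr.1, hr.2.trans hτt⟩

/-- **L14 — THE AMPLITUDE CEILING (Bernstein form).** There are an absolute FINITE constant `A` and the Bernstein
constant `C_B` such that for every `ν > 0`, `T > 0`, every maximal smooth solution `(u, p)` of the unforced
Navier–Stokes system on `ℝ³ × [0, T)` which is Leray–Hopf from `u 0`, all `0 < s ≤ t < T` and every level `j ∈ ℤ`: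
`‖Δ̇_j u(t)‖₂ ≤ ‖Δ̇_j u(s)‖₂ + ∫⁻_{(s,t]} A · ( X_j(τ) + C_B 2^{3j/2} Q_j(τ) ) dτ`, `X_j = ∑_{|m|≤2} a_{j+m} T_{j+m}`
(NEIGHBOUR amplitudes × the Lipschitz size of the coarser levels) and `Q_j` the weighted energy pairs of comparable or
finer levels (notation of `LevelTransferFloor.transfer_floor_local`). Cascade reading: the AMPLITUDE a level receives
during a window is at most `A ×` the time-integral of [neighbour amplitude × coarse strain] plus the fine-pair term; the
receiving level's own state enters only through the `m = 0` strain term `a_j T_j` — exponential growth at the coarse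
strain rate at worst (`LevelStrainClock`), everything else is injected at a rate set by the neighbours. With the floors
(`LevelEnergyFloor`: `a_j > c ν 2^{-j/2}/C` at infinitely many levels of every terminal window) the right-hand side must
deliver that much amplitude, level after level. Ceiling only. [cite: CheskidovDai2015, §3.1 (3.6)] -/
theorem blockL2_le_add_local :
    ∃ (A : ℝ≥0∞) (C : ℝ≥0), A ≠ ∞ ∧ ∀ (ν T : ℝ), 0 < ν → 0 < T →
      ∀ (u : ℝ → EuclideanSpace ℝ (Fin 3) → EuclideanSpace ℝ (Fin 3)) (p : ℝ → EuclideanSpace ℝ (Fin 3) → ℝ),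
      IsMaximalSmoothSolution ν 0 u p T → IsLerayHopfOn T ν 0 (u 0) u →
      ∀ s t : ℝ, 0 < s → s ≤ t → t < T → ∀ j : ℤ,
        blockL2 (u t) j ≤ blockL2 (u s) j + ∫⁻ τ in Ioc s t, A *
          (∑ m ∈ Finset.Icc (-2 : ℤ) 2, blockL2 (u τ) (j + m) *
              paraT (fun l => (2 : ℝ≥0∞) ^ l * blockSup (u τ) l) (j + m) +
            C * (2 : ℝ≥0∞) ^ (3 * (j : ℝ) / 2) *
              paraQ2 (blockL2 (u τ)) (fun l => (2 : ℝ≥0∞) ^ l * blockL2 (u τ) l) j) := by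
  obtain ⟨A, hA, H⟩ := blockL2_le_add_of_forall_le
  obtain ⟨C, -, hB⟩ := exists_blockSup_le_blockL2
  refine ⟨A, C, hA, fun ν T hν hT u p hmax hLH s t hs hst htT j => ?_⟩
  refine H ν T hν hT u p hmax hLH s t hs hst htT j _ fun τ hτ => ?_
  have hτT : τ ∈ Icc 0 T := ⟨(hs.trans hτ.1).le, (hτ.2.trans_lt htT).le⟩
  have hbern := hB (u τ) (hLH.memLp τ hτT) j
  set a := blockL2 (u τ) j
  set X := ∑ m ∈ Finset.Icc (-2 : ℤ) 2, blockL2 (u τ) (j + m) *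
    paraT (fun l => (2 : ℝ≥0∞) ^ l * blockSup (u τ) l) (j + m)
  set Q := paraQ2 (blockL2 (u τ)) (fun l => (2 : ℝ≥0∞) ^ l * blockL2 (u τ) l) j
  calc A * (a * X + blockSup (u τ) j * Q)
      ≤ A * (a * X + C * (2 : ℝ≥0∞) ^ (3 * (j : ℝ) / 2) * a * Q) := by gcongr
    _ = a * (A * (X + C * (2 : ℝ≥0∞) ^ (3 * (j : ℝ) / 2) * Q)) := by ring

end Summit.NavierStokesRegularity.FluidComputer.BlockAmplitudeCeiling

end
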